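import Summits.CriticalPhenomena.PercolationContinuityZ3.Theorems.Transplant.FKConnectivityAllQSPNegDep
import Summits.CriticalPhenomena.PercolationContinuityZ3.Theorems.Transplant.FKConnectivityAllQWagner
import HarnessLib

/-!
# Connectivity correlation inequalities for `φ_{w,q}`, every `q > 0` — file 14d: UPC (every `q > 0`) and single-edge negative
# dependence (`0 < q < 1`) on EVERY `K₄`-MINOR-FREE (= series–parallel) support

Support file (`--supports stmt-CriticalPhenomena-4575`), FK sub-lane `prim-bschramm-fk-2` (gen 8) of the post-continuity
programme; builds on p205010 (kernel theorem, internal audit signed; external expert review pending).  No definitions, no named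
facts, no sorries; standard axioms.

`…AllQSPNegDep.lean` proved, on two-terminal series–parallel networks and on 2-trees, (UPC) `φ(x↔y)·φ(F) ≤ φ({x↔y} ∩ F)` for every
increasing `F` and every `q > 0`, and for `0 < q < 1` (CD) `φ(J_e ∩ F) ≤ φ(J_e)·φ(F)` for every pair `e` and every increasing `F` not
depending on `e`.  With fk-3 g6's structure theorem `FK.exists_isTwoTree_superset_of_not_hasK4Minor` (Dirac 1952 / Duffin 1965 /
Wald–Colbourn 1983: a finite graph without a `K₄` minor lies inside a 2-tree) these transfer verbatim to the standard class:
* **`FK.edgeNegDep_of_noK4Minor`** (`0 < q < 1`): `G` a simple graph on a finite vertex type without a `K₄` minor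
  (`Literature…HasK4Minor`), `w` supported in the edge set of `G` ⇒ for EVERY pair `e` and every increasing event `F` not depending
  on `e`, `φ_{w,q}(J_e ∩ F) ≤ φ_{w,q}(J_e)·φ_{w,q}(F)` — single-edge negative dependence (negative association with a singleton block,
  Grimmett 2006 §3.9; negative regression dependence) of the random-cluster measure with `q < 1` on every series–parallel graph, for all
  weights; `F = J_f` is the discharged named fact `Wagner2008_rc_edgeNegCorr_of_noK4Minor` (fk-3 g6) restricted to loop-free supports.
* **`FK.connUpCorr_of_noK4Minor`** (every `q > 0`): if `G` has no `K₄` minor and contains `supp(w)` and the pair `xy`, then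
  `φ_{w,q}(x ↔ y)·φ_{w,q}(F) ≤ φ_{w,q}({x ↔ y} ∩ F)` for every increasing `F`.
(Loops: a support inside `G.edgeSet` has none; diagonal pairs are independent coins (`…AllQLoops.lean`) and could be re-admitted as in
`Wagner2008_rc_edgeNegCorr_of_noK4Minor_holds` for loop-insensitive `F`; not done here.)
[cite: Grimmett2006, §3.9 (pp. 63–64); Thm. (3.8)] [cite: Wagner2006, Thm. 5.8(d), §5.2, §5.3] [cite: Diestel2017, §7.3 (Prop. 7.3.1, Cor. 7.3.2)]
[cite: BorceaBrandenLiggett2007, Conj. 2.6, §3.4]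
-/

noncomputable section

namespace Summit.CriticalPhenomena.PercolationContinuityZ3.Theorems

namespace FK

open MeasureTheory Set Literature.Probability.LatticeModels Literature.Probability.Percolation
open scoped Classical symmDiff

variable {V : Type*} [Fintype V]

/-- **Single-edge negative dependence of `φ_{w,q}`, `0 < q < 1`, on every `K₄`-minor-free support**: if the simple graph `G` has
no `K₄` minor and `w` is supported in its edge set, then for every pair `e` and every increasing event `F` not depending on `e`,
`φ_{w,q}(J_e ∩ F) ≤ φ_{w,q}(J_e)·φ_{w,q}(F)`. [cite: Grimmett2006, §3.9 (pp. 63–64)] [cite: Wagner2006, Thm. 5.8(d), §5.2, §5.3]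
[cite: Diestel2017, §7.3 (Prop. 7.3.1, Cor. 7.3.2)] -/
theorem edgeNegDep_of_noK4Minor {q : ℝ} (hq0 : 0 < q) (hq1 : q < 1) (G : SimpleGraph V) (hK : ¬ HasK4Minor G)
    (w : Sym2 V → unitInterval) (hw : ∀ e, ((w e : unitInterval) : ℝ) ≠ 0 → e ∈ G.edgeSet) (e : Sym2 V)
    {F : Set (BondConfig V)} (hF : IsUpperSet F) (hFe : ∀ ω : BondConfig V, ω ∆ {e} ∈ F ↔ ω ∈ F) :
    (rcMeasureW w q ∅).real ({ω | e ∈ ω} ∩ F) ≤ (rcMeasureW w q ∅).real {ω | e ∈ ω} * (rcMeasureW w q ∅).real F := by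
  by_cases hwe : ((w e : unitInterval) : ℝ) = 0
  · -- a pair of parameter `0` is almost surely closed
    have h0 : (rcMeasureW w q ∅).real ({ω | e ∈ ω} ∩ F) = 0 := by
      rw [rcMeasureW_real_eq_sum_div w hq0 ∅, sum_rcWeightW_ind_inter_openPair_of_zero w q hwe, zero_div]
    rw [h0]
    exact mul_nonneg measureReal_nonneg measureReal_nonneg
  · -- `e` is an edge of `G`, so `V` has two elements and `G` lies inside a 2-tree containing the support
    have heG : e ∈ G.edgeSet := hw e hwe
    have hV : 1 < Fintype.card V := by
      induction e using Sym2.ind with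
      | h a b => exact Fintype.one_lt_card_iff.2 ⟨a, b, G.ne_of_adj ((SimpleGraph.mem_edgeSet G).1 heG)⟩
    obtain ⟨T, hT, hedges⟩ := exists_isTwoTree_superset_of_not_hasK4Minor G hK hV
    refine edgeNegDep_of_isTwoTree hq0 hq1 hT w (fun g hg => ?_) e hF hFe
    have hgG : g ∈ G.edgeSet := hw g hg
    induction g using Sym2.ind with
    | h a b => exact hedges a b ((SimpleGraph.mem_edgeSet G).1 hgG)

/-- **Conditioning on a connection raises every increasing event, every `q > 0`, on every `K₄`-minor-free support**: if the
simple graph `G` has no `K₄` minor, contains the support of `w` and the pair `xy`, then `φ_{w,q}(x ↔ y)·φ_{w,q}(F) ≤ φ_{w,q}({x ↔ y} ∩ F)`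
for every increasing event `F`. [cite: Grimmett2006, Thm. (3.8); §3.9 (pp. 63–64)] [cite: Wagner2006, Thm. 5.8(d), §5.3]
[cite: Diestel2017, §7.3 (Prop. 7.3.1, Cor. 7.3.2)] -/
theorem connUpCorr_of_noK4Minor {q : ℝ} (hq : 0 < q) (G : SimpleGraph V) (hK : ¬ HasK4Minor G)
    (w : Sym2 V → unitInterval) (hw : ∀ e, ((w e : unitInterval) : ℝ) ≠ 0 → e ∈ G.edgeSet) {x y : V} (hxy : G.Adj x y)
    {F : Set (BondConfig V)} (hF : IsUpperSet F) :
    (rcMeasureW w q ∅).real (openConn x y) * (rcMeasureW w q ∅).real F ≤ (rcMeasureW w q ∅).real (openConn x y ∩ F) := by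
  have hV : 1 < Fintype.card V := Fintype.one_lt_card_iff.2 ⟨x, y, G.ne_of_adj hxy⟩
  obtain ⟨T, hT, hedges⟩ := exists_isTwoTree_superset_of_not_hasK4Minor G hK hV
  refine connUpCorr_of_isTwoTree_of_pos hq hT (hedges x y hxy) w (fun g hg => ?_) hF
  have hgG : g ∈ G.edgeSet := hw g hg
  induction g using Sym2.ind with
  | h a b => exact hedges a b ((SimpleGraph.mem_edgeSet G).1 hgG)

end FK

end Summit.CriticalPhenomena.PercolationContinuityZ3.Theorems

end
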